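import Summits.QuantumFields.YangMills.Theses.UnitScaleTilt
import Literature.MathematicalPhysics.QuantumFieldTheory.Balaban1983to89.T3CruxEstimates

/-!
# Route `UnitScaleTilt` — crux K2 `HistoryTail` (stmt-QuantumFields-18916) REDUCED TO ONE ESTIMATE, INDEPENDENT OF `m`
# (support file; K2 itself stays open)

Cell `ym3-torus` (HUMAN RULING D-0037, YM ladder rung R3), seat `ym3-torus-p2` gen 3.  `unitScaleTilt_historyTail_of_heightTail`:
K2 ⇐ for every `L` some profile `(b₀, p₀)` and threshold `γ₁` such that every family with `F.L = L` and `0 < γ ≤ γ₁` satisfies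
`T3CruxEstimates.HeightTailAt F γ b₀ p₀` — ONE per-height large-field Gibbs tail `q(K−j)` uniform in the cutoff with summable tail
sums (= the relative weight of Bałaban's `ρ_j` on the height-`j` large-field region, `real_gibbsK_iter_mem`; `≤ Σ_p` single-plaquette
tails, `real_not_plaqSmall_comp_le_sum`).  The route's `∀ m > 0` then costs nothing (`T3HistoryTailReduction.summable_comp_div`:
`Σ_K T(⌊K/m⌋) = m·Σ T`).  Printed ingredient: [Balaban1985UV3] (71).  NOT a proof of K2.
-/

noncomputable section

open Literature.MathematicalPhysics.QuantumFieldTheory.Balaban1983to89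
open Literature.MathematicalPhysics.QuantumFieldTheory.Balaban1983to89.T3ContinuumYM3Torus
open Literature.MathematicalPhysics.QuantumFieldTheory.Balaban1983to89.T3UnitScaleTilt
open Literature.MathematicalPhysics.QuantumFieldTheory.Balaban1983to89.T3CruxEstimates
open Summit.QuantumFields.YangMills.Theses.UnitScaleTilt

namespace Summit.QuantumFields.YangMills.Theorems

/-- **K2 ⇐ ONE ESTIMATE, INDEPENDENT OF `m`** (`T3CruxEstimates.HeightTailAt` under the prefix `∀ L, ∃ profile γ₁, ∀ F γ ≤ γ₁`): a
single per-height large-field Gibbs tail profile gives `HistoryTail` at EVERY free top fraction `1/m`. -/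
theorem unitScaleTilt_historyTail_of_heightTail
    (h : ∀ L : ℕ, ∃ b₀ p₀ γ₁ : ℝ, 0 < b₀ ∧ 2 < p₀ ∧ 0 < γ₁ ∧
      ∀ (F : T3Family) (γ : ℝ), F.L = L → 0 < γ → γ ≤ γ₁ → HeightTailAt F γ b₀ p₀) :
    HistoryTail := by
  intro L m hm
  obtain ⟨b₀, p₀, γ₁, hb, hp, hγ₁, h⟩ := h L
  exact ⟨b₀, p₀, γ₁, hb, hp, hγ₁, fun F γ hL hγ hle => historyTailAt_of_heightTailAt F hγ.le hm (h F γ hL hγ hle)⟩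

end Summit.QuantumFields.YangMills.Theorems

end
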